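import Summits.AtomisticToContinuum.Crystallization.Theses.HolmgrenBoyleLind
import Summits.AtomisticToContinuum.Crystallization.Theorems.PalmUnimodularRigidityBenjaminiSchrammLimit
import Summits.AtomisticToContinuum.Crystallization.Theorems.HolmgrenBoyleLindGroundStatesChargeFLCEquilibriumLawChargingTransfers
import Summits.AtomisticToContinuum.Crystallization.Theorems.HolmgrenBoyleLindGroundStatesChargeFLCEquilibriumForceBalance

/-!
# Crux `HolmgrenBoyleLind.GroundStatesChargeFLCEquilibrium` (stmt-AtomisticToContinuum-6076),
# line `registered`: the crux CLOSED MODULO its content stub, in the tree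

`groundStatesChargeFLCEquilibrium_of_minimisingLawsChargeFLC : MinimisingLawsChargeFLC → LIM` —
the skeleton `Cruxes/GroundStatesChargeFLCEquilibrium/Lines/birth.lean` of the line with every
glue stub DISCHARGED by landed theorems: the Benjamini–Schramm limit of the ground states
(`benjaminiSchrammLimit_proof`, item 9230), the energy limit (`CrysEnergyLimit_holds`, item 0626,
so the limit law is minimising), the density transfer `stub_lawChargingTransfers` (law-level
charging ⇒ positive density of matched particles, eventually along the subsequence, hence
frequently in `N`) and finite-`N` criticality ⇒ force balance `forceBalanceOfChargedPatches`.
What remains as the HYPOTHESIS is the content stub `stub_minimisingLawsChargeFLC` of the line,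
stated verbatim (law level, open-problem strength: every minimising point-stationary hard-core
law charges at every scale, at one base point, the patches of ONE FLC Delone set — Palm-side
positional crystallization with an FLC, not periodic, conclusion; BlancLewin2015 §2.3).

Corollaries (separate files): `PeriodicSupport → LIM` through the landed reduction
`stub_minimisingLawsChargeFLC_of_periodicSupport` (item 12747 of route `BenjaminiSchrammPeriodicSupport`),
and `GroundStatesChargePeriodic → LIM` (item 2911). CONDITIONAL result; nothing here closes an
item. [folklore]
-/

noncomputable section

open MeasureTheory Filter
open scoped ENNReal Topology
open Literature.MathematicalPhysics.StatisticalMechanics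

namespace Summit.AtomisticToContinuum.Crystallization.Theorems.HolmgrenBoyleLindGroundStatesChargeFLCEquilibrium

/-- **The crux modulo its content stub.** If every minimising point-stationary hard-core law on
rooted configurations of `ℝ³` charges, at every scale `(R, ε)` and at one base point, the patches
of ONE `δ'`-separated, `r`-dense set of finite local complexity (the line's stub
`stub_minimisingLawsChargeFLC`, hypothesis verbatim), then `GroundStatesChargeFLCEquilibrium` holds:
the Benjamini–Schramm limit of the given ground states (proved) is such a law (minimising by the
proved energy limit), the charged set `Λ` is transferred to a positive density of matched particles
frequently in `N` (`stub_lawChargingTransfers`, landed), and `Λ` is in exact force balance at every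
point by finite-`N` criticality (`forceBalanceOfChargedPatches`, landed). [folklore] -/
theorem groundStatesChargeFLCEquilibrium_of_minimisingLawsChargeFLC :
    (∀ δ : ℝ, 0 < δ → ∀ P : Measure (Measure (EuclideanSpace ℝ (Fin 3))), IsProbabilityMeasure P →
      (∀ᵐ μ ∂P, (∃ S : Set (EuclideanSpace ℝ (Fin 3)), (0 : EuclideanSpace ℝ (Fin 3)) ∈ S ∧
        (∀ x ∈ S, ∀ y ∈ S, x ≠ y → δ ≤ dist x y) ∧
        μ = (Measure.count : Measure (EuclideanSpace ℝ (Fin 3))).restrict S)) →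
      (∀ g : Measure (EuclideanSpace ℝ (Fin 3)) → EuclideanSpace ℝ (Fin 3) → ENNReal,
        Measurable (Function.uncurry g) →
        ∫⁻ μ, ∫⁻ y, g μ y ∂μ ∂P = ∫⁻ μ, ∫⁻ y, g (Measure.map (fun z => z - y) μ) (-y) ∂μ ∂P) →
      (∫ μ, (∫ y, lennardJones ‖y‖ ∂μ) / 2 ∂P) ≤
        (⨅ Q : PeriodicConfiguration 3, Q.energyPerParticle lennardJones) →
      ∃ (Λ : Set (EuclideanSpace ℝ (Fin 3))) (δ' r : ℝ), 0 < δ' ∧ 0 < r ∧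
        (∀ x ∈ Λ, ∀ y ∈ Λ, x ≠ y → δ' ≤ dist x y) ∧
        (∀ c : EuclideanSpace ℝ (Fin 3), ∃ y ∈ Λ, dist y c ≤ r) ∧
        (∀ R : ℝ, Set.Finite {S : Set (EuclideanSpace ℝ (Fin 3)) |
          ∃ x ∈ Λ, S = {v : EuclideanSpace ℝ (Fin 3) | x + v ∈ Λ ∧ ‖v‖ ≤ R}}) ∧
        ∃ q₀ ∈ Λ, ∀ R ε : ℝ, 0 < R → 0 < ε →
          P {ν : Measure (EuclideanSpace ℝ (Fin 3)) |
              ∃ A : EuclideanSpace ℝ (Fin 3) →ₗᵢ[ℝ] EuclideanSpace ℝ (Fin 3),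
                (∀ s ∈ Λ, dist s q₀ ≤ R →
                  ∃ p : EuclideanSpace ℝ (Fin 3), ν {p} ≠ 0 ∧ dist p (A (s - q₀)) ≤ ε) ∧
                (∀ p : EuclideanSpace ℝ (Fin 3), ν {p} ≠ 0 → ‖p‖ ≤ R →
                  ∃ s ∈ Λ, dist p (A (s - q₀)) ≤ ε)} ≠ 0) →
    Summit.AtomisticToContinuum.Crystallization.Theses.HolmgrenBoyleLind.GroundStatesChargeFLCEquilibrium := by
  intro hFLC x hx
  -- the proved Benjamini–Schramm limit of the ground states (item 9230)
  obtain ⟨φ, hφ, δ, hδ, P, hP, hcore, hstat, hE, htr⟩ :=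
    Summit.AtomisticToContinuum.Crystallization.Theorems.benjaminiSchrammLimit_proof x hx
  -- the limit law is minimising: `E_P[h] = lim E(φ j)/φ j = e*` (item 0626, proved)
  have hLim : Filter.Tendsto (fun N : ℕ => groundStateEnergy lennardJones 3 N / N) Filter.atTop
      (nhds (⨅ Q : PeriodicConfiguration 3, Q.energyPerParticle lennardJones)) :=
    Summit.AtomisticToContinuum.Crystallization.Theses.PalmUnimodularRigidity.CrysEnergyLimit_holds
  have hlim' : Filter.Tendsto (fun j : ℕ => groundStateEnergy lennardJones 3 (φ j) / (φ j : ℝ))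
      Filter.atTop (nhds (⨅ Q : PeriodicConfiguration 3, Q.energyPerParticle lennardJones)) :=
    hLim.comp hφ.tendsto_atTop
  have hEq := tendsto_nhds_unique hE hlim'
  -- stub 1: one FLC Delone set charged at the law level at a base point `q₀`
  obtain ⟨Λ, δ', r, hδ', hr, hsep, hden, hflc, q₀, hq₀, hch⟩ := hFLC δ hδ P hP hcore hstat hEq.le
  -- density transfer (landed stub 2) to the configurations `x (φ j)`, eventually in `j`
  have hfin := stub_lawChargingTransfers x φ P hP htr Λ q₀ hch
  have hφpos : ∀ᶠ j : ℕ in Filter.atTop, 0 < φ j :=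
    hφ.tendsto_atTop.eventually (Filter.eventually_gt_atTop 0)
  refine ⟨Λ, δ', r, hδ', hr, hsep, hden, hflc, ?_, ?_⟩
  · -- force balance at every point: finite-`N` criticality (landed stub 3), one matched particle per scale
    refine forceBalanceOfChargedPatches Λ δ' hδ' hsep q₀ hq₀ ?_
    intro R ε hR hε
    obtain ⟨ρ, hρ, hev⟩ := hfin R ε hR hε
    obtain ⟨j, hj, hj0⟩ := (hev.and hφpos).exists
    have hρN : (0 : ℝ) < ρ * (φ j : ℝ) := mul_pos hρ (Nat.cast_pos.2 hj0)
    have hcard := lt_of_lt_of_le hρN hj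
    rw [Nat.cast_pos] at hcard
    obtain ⟨⟨⟨i, A, hA₁, hA₂⟩⟩, -⟩ := Nat.card_pos_iff.1 hcard
    exact ⟨φ j, x (φ j), i, A, hx (φ j), hA₁, hA₂⟩
  · -- the charging clause of the crux, base point `q₀`, frequently in `N`
    intro R ε hR hε
    obtain ⟨ρ, hρ, hev⟩ := hfin R ε hR hε
    refine ⟨ρ, hρ, ?_⟩
    -- the crux's predicate (base point inside) and monotonicity of the count from the base point `q₀`
    set good : (N : ℕ) → Fin N → Prop := fun N i =>
      ∃ A : EuclideanSpace ℝ (Fin 3) →ₗᵢ[ℝ] EuclideanSpace ℝ (Fin 3), ∃ q ∈ Λ,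
        (∀ s ∈ Λ, dist s q ≤ R → ∃ k : Fin N, dist (x N k) (x N i + A (s - q)) ≤ ε) ∧
        (∀ k : Fin N, dist (x N k) (x N i) ≤ R →
          ∃ s ∈ Λ, dist (x N k) (x N i + A (s - q)) ≤ ε)
      with hgood
    have himp : ∀ (N : ℕ) (i : Fin N),
        (∃ A : EuclideanSpace ℝ (Fin 3) →ₗᵢ[ℝ] EuclideanSpace ℝ (Fin 3),
          (∀ s ∈ Λ, dist s q₀ ≤ R → ∃ k : Fin N, dist (x N k) (x N i + A (s - q₀)) ≤ ε) ∧
          (∀ k : Fin N, dist (x N k) (x N i) ≤ R →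
            ∃ s ∈ Λ, dist (x N k) (x N i + A (s - q₀)) ≤ ε)) → good N i :=
      fun N i hi => hi.imp fun A hA => ⟨q₀, hq₀, hA⟩
    have hev' : ∀ᶠ j : ℕ in Filter.atTop,
        ρ * ((φ j : ℕ) : ℝ) ≤ (Nat.card {i : Fin (φ j) // good (φ j) i} : ℝ) := by
      filter_upwards [hev] with j hj
      refine hj.trans ?_
      exact_mod_cast Nat.card_le_card_of_injective _
        (Subtype.map_injective (fun i hi => himp (φ j) i hi) Function.injective_id)
    exact hφ.tendsto_atTop.frequently
      (p := fun N : ℕ => ρ * (N : ℝ) ≤ (Nat.card {i : Fin N // good N i} : ℝ)) hev'.frequently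


end Summit.AtomisticToContinuum.Crystallization.Theorems.HolmgrenBoyleLindGroundStatesChargeFLCEquilibrium

end
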